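import Summits.CriticalPhenomena.PercolationContinuityZ3.Theorems.Transplant.Z3RowDilutedNoSkeleton
import Mathlib.Tactic.FinCases
import HarnessLib

/-!
# A STABILISER OBSTRUCTION for the skeleton interfaces, in purely graph-theoretic form: **a graph with a vertex of degree `4` one of whose
# neighbours is the ONLY neighbour of its degree carries NO `PlanarSkeletonNeg` (hence no `PlanarSkeletonSign`, no `PlanarSkeletonConc`) —
# for ANY chart and ANY base set**; instances: the row-diluted stackings `R_k` (file X, re-derived in one line) and the COLUMN-diluted stackings
# `C_k` (one rung column per `k × k` block of sites; `C_2` = the `sparse` net is PROVED, `C_k`, `k ≥ 3`, is void)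

builds on p205010 (kernel theorem, internal audit signed; external expert review pending) — only `colNet_two_criticalContinuity` (= file IV's
`sparse_criticalContinuity`) uses it; the obstruction uses nothing of it.
Lane `prim-bschramm`, seat `prim-bschramm-p2` (gen 12; class C1b); helper file (`--supports stmt-CriticalPhenomena-4575 --as helper`).  Memo:
`HOME/bschramm/P2-LATTICES.md` §36 (9)/(11).  Companion of p2-g10's `SkeletonDegreeObstruction` (degree `≤ 3`): here the degree is `4` and the
obstruction is the STABILISER — frames carry the configuration to a base vertex `t`, every automorphism fixing `t` fixes the distinguished neighbour
(unique degree), but the central inversion `neg` at `t` must reverse its nonzero chart displacement ((ι) exhausts the four neighbours of `t`).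
* §1 **`PlanarSkeletonNeg.isEmpty_of_unique_degree_neighbour`** (+ `PlanarSkeletonSign` / `PlanarSkeletonConc` corollaries);
* §2 `Z3Net.rowNet_isEmpty_skeletonNeg'` (file X's negative as a one-line instance);
* §3 the column-diluted stackings: `colSteps`, `colNet k`, degrees, **`colNet_isEmpty_skeletonNeg (hk : 3 ≤ k)`**, `colNet_two_graph : (colNet 2).graph
  = sparse.net.graph`, `colNet_two_criticalContinuity`.
[cite: KozmaNitzan2024, §4 p. 15 (outward steps), p. 16 (Lemma 8: the lattice symmetries)] [cite: BenjaminiSchramm1996, §2, Conj. 4]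
-/

noncomputable section

namespace Summit.CriticalPhenomena.PercolationContinuityZ3.Theorems.Transplant

open MeasureTheory Literature.Probability.Percolation Literature.Probability.LatticeModels SimpleGraph
open Z3Diag (ev proj)
open scoped Classical

/-! ## §1 The obstruction -/

namespace PlanarSkeletonNeg

variable {V : Type} {G : SimpleGraph V} [G.LocallyFinite]

/-- **THE STABILISER OBSTRUCTION (graph-theoretic form)**: if some vertex `v` of degree `4` has a neighbour `w` that is the only neighbour of `v` of
its degree, then `G` carries no `PlanarSkeletonNeg` — whatever the chart and the base set.  (A frame `α t = v` from a base vertex `t`; the neighbour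
`α⁻¹ w` of `t` is fixed by every automorphism fixing `t`, by degree; `false_of_rigid_neighbour`.) [cite: KozmaNitzan2024, §4 p. 16 (Lemma 8)] -/
theorem isEmpty_of_unique_degree_neighbour {v w : V} (hv : G.degree v = 4) (hw : G.Adj v w)
    (huniq : ∀ w', G.Adj v w' → G.degree w' = G.degree w → w' = w) : IsEmpty (PlanarSkeletonNeg G) := by
  refine ⟨fun Φ => ?_⟩
  obtain ⟨t, ht, α, hαt, -⟩ := Φ.frame v
  have hdeg : G.degree t = 4 := by rw [← α.degree_eq t, hαt, hv]
  have hadj : G.Adj t (α.symm w) := by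
    rw [← α.map_adj_iff, hαt, RelIso.apply_symm_apply]; exact hw
  refine Φ.false_of_rigid_neighbour ht hdeg hadj fun ρ hρt => ?_
  have h1 : G.Adj v (α (ρ (α.symm w))) := by
    have h := α.map_adj_iff.2 (ρ.map_adj_iff.2 hadj)
    rwa [hρt, hαt] at h
  have h2 : G.degree (α (ρ (α.symm w))) = G.degree w := by
    rw [α.degree_eq, ρ.degree_eq, α.symm.degree_eq]
  have h3 := huniq _ h1 h2
  have := congrArg α.symm h3
  rwa [RelIso.symm_apply_apply] at this

end PlanarSkeletonNeg

/-- … hence no `PlanarSkeletonSign`. [folklore] -/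
theorem isEmpty_planarSkeletonSign_of_unique_degree_neighbour {V : Type} {G : SimpleGraph V} [G.LocallyFinite] {v w : V}
    (hv : G.degree v = 4) (hw : G.Adj v w) (huniq : ∀ w', G.Adj v w' → G.degree w' = G.degree w → w' = w) :
    IsEmpty (PlanarSkeletonSign G) :=
  ⟨fun Φ => (PlanarSkeletonNeg.isEmpty_of_unique_degree_neighbour hv hw huniq).false Φ.toPlanarSkeletonNeg⟩

/-- … hence no `PlanarSkeletonConc` (the node of record's interface). [folklore] -/
theorem isEmpty_planarSkeletonConc_of_unique_degree_neighbour {V : Type} {G : SimpleGraph V} [G.LocallyFinite] {v w : V}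
    (hv : G.degree v = 4) (hw : G.Adj v w) (huniq : ∀ w', G.Adj v w' → G.degree w' = G.degree w → w' = w) :
    IsEmpty (PlanarSkeletonConc G) :=
  ⟨fun Φ => (PlanarSkeletonNeg.isEmpty_of_unique_degree_neighbour hv hw huniq).false Φ.toNeg⟩

/-! ## §2 The row-diluted stackings, in one line -/

namespace Z3Net

/-- File X's negative as an instance: in `R_k`, `k ≥ 3`, the vertex `e₀` has degree `4` and `0` is its only neighbour of degree `6`.
[cite: KozmaNitzan2024, §4 p. 16 (Lemma 8)] -/
theorem rowNet_isEmpty_skeletonNeg' {k : ℕ} (hk : 3 ≤ k) : IsEmpty (PlanarSkeletonNeg (rowNet k).graph) := by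
  have hk1 : ¬ (k : ℤ) ∣ (ev 0 : Site 3) 0 := by
    simp only [ev, Pi.single_eq_same]
    intro h; have := Int.le_of_dvd one_pos h; omega
  have h0 : (rowNet k).graph.degree (0 : Site 3) = 6 := rowNet_degree_of_dvd (by simp)
  exact PlanarSkeletonNeg.isEmpty_of_unique_degree_neighbour (rowNet_degree_of_not_dvd hk1)
    ((rowNet_adj_ev_zero_iff (by omega) 0).2 (Or.inr (Or.inl rfl)))
    (fun w' h1 h2 => rowNet_eq_zero_of_adj_ev_zero hk h1 (by rw [h2, h0]))

/-! ## §3 The column-diluted stackings `C_k` -/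

/-- The steps of `C_k` at `x`: `±e₀, ±e₁` always, `±e₂` iff `k ∣ x₀` and `k ∣ x₁` (one vertical line of rungs per `k × k` block). [folklore] -/
def colSteps (k : ℕ) (x : Site 3) : Finset (Site 3) :=
  {ev 0, -ev 0, ev 1, -ev 1} ∪ (if (k : ℤ) ∣ x 0 ∧ (k : ℤ) ∣ x 1 then {ev 2, -ev 2} else ∅)

/-- Membership in `colSteps`. [folklore] -/
theorem mem_colSteps_iff {k : ℕ} {x s : Site 3} :
    s ∈ colSteps k x ↔ (s = ev 0 ∨ s = -ev 0 ∨ s = ev 1 ∨ s = -ev 1) ∨ (((k : ℤ) ∣ x 0 ∧ (k : ℤ) ∣ x 1) ∧ (s = ev 2 ∨ s = -ev 2)) := by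
  rw [colSteps, Finset.mem_union]
  simp only [Finset.mem_insert, Finset.mem_singleton]
  split_ifs with h <;> simp [h]

/-- **The column-diluted stacking `C_k`** as a net on `ℤ³`. [cite: BenjaminiSchramm1996, §2] -/
def colNet (k : ℕ) : Z3Net where
  stepsAt := colSteps k
  zero_notMem x := by
    rw [mem_colSteps_iff]
    rintro ((h | h | h | h) | ⟨-, h | h⟩)
    · exact (RungPattern.zero_ne_ev 0).1 h
    · exact (RungPattern.zero_ne_ev 0).2 h
    · exact (RungPattern.zero_ne_ev 1).1 h
    · exact (RungPattern.zero_ne_ev 1).2 h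
    · exact (RungPattern.zero_ne_ev 2).1 h
    · exact (RungPattern.zero_ne_ev 2).2 h
  symm x s hs := by
    rw [mem_colSteps_iff] at hs ⊢
    rcases hs with (rfl | rfl | rfl | rfl) | ⟨hx, rfl | rfl⟩
    · exact Or.inl (Or.inr (Or.inl rfl))
    · exact Or.inl (Or.inl (neg_neg _))
    · exact Or.inl (Or.inr (Or.inr (Or.inr rfl)))
    · exact Or.inl (Or.inr (Or.inr (Or.inl (neg_neg _))))
    · exact Or.inr ⟨by simpa [ev] using hx, Or.inr rfl⟩
    · exact Or.inr ⟨by simpa [ev] using hx, Or.inl (neg_neg _)⟩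

/-- The steps of `C_k`. [folklore] -/
@[simp] theorem colNet_stepsAt (k : ℕ) (x : Site 3) : (colNet k).stepsAt x = colSteps k x := rfl

/-- Degree `6` on the rung columns. [folklore] -/
theorem colNet_degree_of_dvd {k : ℕ} {x : Site 3} (hx : (k : ℤ) ∣ x 0 ∧ (k : ℤ) ∣ x 1) : (colNet k).graph.degree x = 6 := by
  rw [Z3Net.degree_eq, colNet_stepsAt, colSteps, if_pos hx]
  decide

/-- Degree `4` off the rung columns. [folklore] -/
theorem colNet_degree_of_not {k : ℕ} {x : Site 3} (hx : ¬ ((k : ℤ) ∣ x 0 ∧ (k : ℤ) ∣ x 1)) : (colNet k).graph.degree x = 4 := by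
  rw [Z3Net.degree_eq, colNet_stepsAt, colSteps, if_neg hx]
  decide

/-- Degree `6` characterises the rung columns. [folklore] -/
theorem colNet_degree_eq_six_iff {k : ℕ} {x : Site 3} : (colNet k).graph.degree x = 6 ↔ (k : ℤ) ∣ x 0 ∧ (k : ℤ) ∣ x 1 := by
  by_cases hx : (k : ℤ) ∣ x 0 ∧ (k : ℤ) ∣ x 1
  · exact ⟨fun _ => hx, fun _ => colNet_degree_of_dvd hx⟩
  · rw [colNet_degree_of_not hx]
    exact ⟨fun h => absurd h (by norm_num), fun h => absurd h hx⟩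

/-- The neighbours of `e₀` in `C_k`, `k ≥ 2`: the four in-layer ones. [folklore] -/
theorem colNet_adj_ev_zero_iff {k : ℕ} (hk : 2 ≤ k) (w : Site 3) :
    (colNet k).graph.Adj (ev 0) w ↔ w = ev 0 + ev 0 ∨ w = 0 ∨ w = ev 0 + ev 1 ∨ w = ev 0 - ev 1 := by
  have h1 : ¬ ((k : ℤ) ∣ (ev 0 : Site 3) 0 ∧ (k : ℤ) ∣ (ev 0 : Site 3) 1) := by
    simp only [ev, Pi.single_eq_same]
    rintro ⟨h, -⟩; have := Int.le_of_dvd one_pos h; omega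
  rw [Z3Net.graph_adj_iff, colNet_stepsAt, mem_colSteps_iff]
  simp only [h1, false_and, or_false, sub_eq_iff_eq_add']
  have e2 : ev 0 + -ev 0 = (0 : Site 3) := by rw [add_neg_cancel]
  have e4 : ev 0 + -ev 1 = (ev 0 - ev 1 : Site 3) := by rw [sub_eq_add_neg]
  rw [e2, e4]

/-- **KERNEL NEGATIVE: for `k ≥ 3` the column-diluted stacking `C_k` carries NO `PlanarSkeletonNeg`** (any chart, any base set): `e₀` has degree `4`
and `0` is its only neighbour of degree `6`. [cite: KozmaNitzan2024, §4 p. 16 (Lemma 8)] -/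
theorem colNet_isEmpty_skeletonNeg {k : ℕ} (hk : 3 ≤ k) : IsEmpty (PlanarSkeletonNeg (colNet k).graph) := by
  have hk1 : ¬ ((k : ℤ) ∣ (ev 0 : Site 3) 0 ∧ (k : ℤ) ∣ (ev 0 : Site 3) 1) := by
    simp only [ev, Pi.single_eq_same]
    rintro ⟨h, -⟩; have := Int.le_of_dvd one_pos h; omega
  have h0 : (colNet k).graph.degree (0 : Site 3) = 6 := colNet_degree_of_dvd (by simp)
  refine PlanarSkeletonNeg.isEmpty_of_unique_degree_neighbour (colNet_degree_of_not hk1)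
    ((colNet_adj_ev_zero_iff (by omega) 0).2 (Or.inr (Or.inl rfl))) (fun w' h1 h2 => ?_)
  rw [h0, colNet_degree_eq_six_iff] at h2
  rcases (colNet_adj_ev_zero_iff (by omega) w').1 h1 with rfl | rfl | rfl | rfl
  · exfalso; have h := h2.1; simp [ev] at h; have := Int.le_of_dvd two_pos h; omega
  · rfl
  · exfalso; have h := h2.1; simp [ev] at h; have := Int.le_of_dvd one_pos h; omega
  · exfalso; have h := h2.1; simp [ev] at h; have := Int.le_of_dvd one_pos h; omega

/-- **`C_2` is the `sparse` net of file IV** (rungs over the sites with both planar coordinates even). [folklore] -/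
theorem colNet_two_graph : (colNet 2).graph = RungPattern.sparse.net.graph := by
  ext x y
  rw [Z3Net.graph_adj_iff, Z3Net.graph_adj_iff, colNet_stepsAt, mem_colSteps_iff, RungPattern.net_stepsAt, RungPattern.mem_stepsAt_iff]
  have e1 : RungPattern.sparse.A x ↔ (2 : ℤ) ∣ x 0 ∧ (2 : ℤ) ∣ x 1 := by
    show (Even (x 0) ∧ Even (x 1)) ↔ _
    rw [even_iff_two_dvd, even_iff_two_dvd]
  have e2 : RungPattern.sparse.A (x - ev 2) ↔ (2 : ℤ) ∣ x 0 ∧ (2 : ℤ) ∣ x 1 := by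
    show (Even ((x - ev 2) 0) ∧ Even ((x - ev 2) 1)) ↔ _
    simp [ev, even_iff_two_dvd]
  rw [e1, e2]
  simp only [Nat.cast_ofNat]
  tauto

/-- **`θ(v, p_c) = 0` on `C_2`** (= `sparse_criticalContinuity`). builds on p205010 (kernel theorem, internal audit signed; external expert review
pending). [cite: BenjaminiSchramm1996, Conj. 4] -/
theorem colNet_two_criticalContinuity (v : Site 3) : theta (colNet 2).graph v (criticalProbIOf (colNet 2).graph v) = 0 := by
  rw [colNet_two_graph]; exact RungPattern.sparse_criticalContinuity v

end Z3Net

end Summit.CriticalPhenomena.PercolationContinuityZ3.Theorems.Transplant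

end
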